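import Summits.QuantumFields.BalabanUV.Gaps.CapSignsRefutationSocket
import Summits.QuantumFields.BalabanUV.Gaps.CapBlockTransferFloors
import Summits.QuantumFields.BalabanUV.Beta.RemainderExplicitSplitUnique

/-!
# Gaps / CapNegSocketOnePoint — the refutation socket of row CAP-k at its WEAKEST non-certificate input: ONE-POINT continuity of `β_{k+1}` at
# the ZERO HISTORY, at the ONE scale where `β⁰_{k+1} < 0` is certified; and the same socket TRANSFERRED along block sums to the block size `L^n`
# (cell pub-balaban-gaps, seat g1-p3 gen 4, CAP+tail charge; §§1–4 ADOPT g1-plan-2 GEN 10's lens kernel `g1/skeletons/XreadNegSocketOnePoint_plan2.lean`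
# d138fa26e908bf1d (X-67) on the planner's «no refusal» disposition [G1-PLAN2-G10-X66-X67] — re-based on the LANDED (g)
# `CapSignsRefutationSocket.not_thm2Printed_of_beta0_neg_oneScale` and on d4-p3's `RemainderExplicitSplitUnique.β0_eq_apply_zero` instead of
# re-deriving them, with the planner's `def Orthant` written out as the set `{p ∣ ∀ i, 0 < p i}`; §§5–6 are this seat's)

HONEST FRAMING (cell rule, page 1 of everything): bookkeeping; NOTHING of Bałaban's is asserted beyond print; [Balaban1987RG1] Thm 2 is UNPROVED
IN PRINT; NO coefficient of Bałaban's β⁰ and NO enclosure of his β_{k+1} is certified to date (b2b BETA/CERT.md: «0 coefficients»); the block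
composition hypothesis `hblock` ∕ `NearRate` of §6 (one-loop coefficients at block size `L^n` = block sums of those at block size `L`) is asym1's
located question Q-asym1-5 — a BINDER, never asserted (`Beta.RateCertificate` §10–§11; this seat's `CapBlockTransferFloors`); this file only
NAMES the exits a certified negative finding would take; 0 binders discharged; NOT `BetaPertH`, NOT the continuum limit, NOT Clay.  HONEST
DEPENDENCY (b2b cell, verbatim): «continuum YM on T⁴ ⇐ BetaPertH ∧ nine spine estimates (0/9 proved); BetaPertH ⇐ (D1) ∧ (D4) ∧ CAP+tail;
G-an2-4 gates asym, D1 and NE2/3/4.»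

CONTENT.  (g) recorded the refuting certificate for (0.31) as typed as «ONE certified `β⁰_{k+1} < 0` + the one-sided ONE-SCALE near-zero
control `hRk : ∀ ε > 0, ∃ γ > 0, ∀ p ∈ ]0,γ]^{k+1}, β¹_{k+1}(p) ≤ ε`» (`not_thm2Printed_of_beta0_neg_oneScale`; S-18 called `hRk` «(D4)-type, open»).
§1 (X-67) `hRk` is NOT a (D4)-type remainder bound — it is implied by the QUALITATIVE clause «`β_{k+1}` (equivalently `β¹_{k+1}`) is continuous AT
   THE ZERO HISTORY from inside the orthant» (`ContinuousWithinAt (β k) {p ∣ ∀ i, 0 < p i} 0`), because the printed vanishing `β¹_{k+1}|_{g_k=0} = 0`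
   ((2.12)–(2.14) p. 268, `OneLoopSplit.vanish`; `β_{k+1}(0) = β⁰_{k+1}` is d4-p3's `β0_eq_apply_zero`) pins the value at the corner:
   `hRk_of_beta1_continuousWithinAt_zero`, `beta1_continuousWithinAt_zero_of_beta`, `hRk_of_beta_continuousWithinAt_zero`.
§2 (X-67) **`not_thm2Printed_of_beta0_neg_onePoint`**: ONE certified `β⁰_{k+1} < 0` + one-point continuity at the zero history at THAT scale
   ⟹ `¬ B12.Thm2Printed C L` for every forward-generated `C`, every `L > 1` (via (g)'s `_oneScale`); `_cert_onePoint` (certified majorant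
   `β⁰_{k+1} ≤ m < 0`); `β¹`-currency `not_thm2Printed_of_beta0_neg_onePoint'`.
§3 (X-67) the printed one-variable case ([I] p. 264, the (1.22) sentence «β_{j+1}(g_j) … a smooth function defined on the interval [0, γ]»,
   CLOSED at 0): `continuousWithinAt_zero_of_lastVar`, `not_thm2Printed_of_beta0_neg_lastVar`.
§4 (X-67) binder (C) does NOT supply the clause (`BetaContH` lives on `]0,γ]^{k+1}`, `zero_not_mem_box`) …
§5 (this seat) … but (g)'s closed-box supplier DOES, at one scale: continuity of `β_{k+1}` within the CLOSED box `[0,γ]^{k+1}` at the corner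
   ⟹ the orthant clause (`continuousWithinAt_orthant_of_closedBox`); so the inputs of the refutation road are ordered
   closed-box continuity at all scales ((g) `_closedBox`) ⟹ at one scale ⟹ one-point orthant continuity (here) ⟹ `hRk` ((g) `_oneScale`).
§6 (this seat) THE SOCKET AT BLOCK SIZE `L' = L^n` FROM SMALL-BLOCK DATA (Q-asym1-5 currency of `CapBlockTransferFloors`): under
   `hblock : ∀ k, S'.β0 k = blockSum n b k` a certified NEGATIVE block sum of `n` consecutive small-block coefficients + one-point continuity of the
   `L'`-construction's `β_{k+1}` at zero ⟹ `¬ B12.Thm2Printed C' L'` (`not_thm2Printed_of_blockSum_neg_onePoint`; nearness form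
   `not_thm2Printed_of_blockSum_near_neg_onePoint` with `blockSum n b k + e·ϑ^k < 0`; certificate form `_blockCert_` from rational majorants of the
   small-block coefficients); and **`twoSidedTest_block_limitForm`**: on the limit-form road of the `L'`-construction, positive block sums below
   `k₀` ⟹ (0.31) at `L'`, one negative block sum (+ the one-point clause) ⟹ ¬(0.31) at `L'`; `thm2Printed_pow_of_smallBlockSigns` (signs of the
   first `n·k₀` SMALL-block coefficients suffice for the positive side).  NUMBERS (`pow_blockSizes`): the printed block sizes are «L odd > 11»
   (p. 251); `2^n` is never odd (`2^4 = 16`), `3^3 = 27` and `5^2 = 25` are odd and `> 11` — so under Q-asym1-5 a certified finding at block size 3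
   or 5 bears on a printed block size, one at block size 2 (the CA-1 ∕ ENGINE-A instance `β⁰₃(2; SU(2))`) on none.
All [folklore] unless cited; 0 sorry; 0 def; restates nothing ((g), `CapBlockTransferFloors`, `RemainderExplicitSplitUnique`, `CapTailSigns` used by name).
-/

namespace Summit.QuantumFields.BalabanUV.Gaps.CapNegSocketOnePoint

open Literature.MathematicalPhysics.QuantumFieldTheory.Balaban1983to89
open Literature.MathematicalPhysics.QuantumFieldTheory.Balaban1983to89.FlowStep
open Literature.MathematicalPhysics.QuantumFieldTheory.Balaban1983to89.DagBinding
open Literature.MathematicalPhysics.QuantumFieldTheory.Balaban1983to89.B12Beta (OneLoopSplit HistBox)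
open Literature.MathematicalPhysics.QuantumFieldTheory.Balaban1983to89.Beta.RateCertificate (NearRate blockSum)
open Summit.QuantumFields.BalabanUV.Gaps.CapSignsRefutationSocket (not_thm2Printed_of_beta0_neg_oneScale)
open Summit.QuantumFields.BalabanUV.Beta.RemainderExplicitSplitUnique (β0_eq_apply_zero)
open scoped Topology

noncomputable section

variable {β : HBeta}

/-! ## §1 (X-67) One-point continuity at the zero history ⟹ the one-sided one-scale control `hRk` -/

/-- Histories in `]0,γ]^{k+1}` lie in the open orthant `{p ∣ ∀ i, 0 < p i}`. [folklore] -/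
theorem histBox_subset_orthant {γ : ℝ} {k : ℕ} : HistBox γ k ⊆ {p : Fin (k + 1) → ℝ | ∀ i, 0 < p i} := fun _ hp i => (hp i).1

/-- Histories in `]0,γ]^{k+1}` are sup-close to the zero history: `dist p 0 < δ` whenever `γ < δ`. [folklore] -/
theorem dist_zero_lt_of_histBox {γ δ : ℝ} {k : ℕ} (hγδ : γ < δ) (hδ : 0 < δ) {p : Fin (k + 1) → ℝ} (hp : p ∈ HistBox γ k) :
    dist p 0 < δ := by
  rw [dist_pi_lt_iff hδ]
  intro i
  rw [Real.dist_eq, Pi.zero_apply, sub_zero, abs_of_pos (hp i).1]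
  exact (hp i).2.trans_lt hγδ

/-- **X-67 §1**: continuity of `β¹_{k+1}` AT THE ZERO HISTORY from inside the orthant (one point, one scale) gives (g)'s clause `hRk`
verbatim: `∀ ε > 0, ∃ γ > 0, ∀ p ∈ ]0,γ]^{k+1}, β¹_{k+1}(p) ≤ ε` — by the printed vanishing `β¹_{k+1}(0,…,0) = 0`.
[cite: Balaban1987RG1, (2.12)-(2.14) p.268] -/
theorem hRk_of_beta1_continuousWithinAt_zero (S : OneLoopSplit β) {k : ℕ}
    (hc : ContinuousWithinAt (S.β1 k) {p : Fin (k + 1) → ℝ | ∀ i, 0 < p i} 0) :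
    ∀ ε : ℝ, 0 < ε → ∃ γ : ℝ, 0 < γ ∧ ∀ p ∈ HistBox γ k, S.β1 k p ≤ ε := by
  intro ε hε
  obtain ⟨δ, hδ, hδ'⟩ := Metric.continuousWithinAt_iff.mp hc ε hε
  refine ⟨δ / 2, by positivity, fun p hp => ?_⟩
  have h := hδ' (histBox_subset_orthant hp) (dist_zero_lt_of_histBox (by linarith) hδ hp)
  have h0 : S.β1 k 0 = 0 := S.vanish k 0 rfl
  rw [h0, Real.dist_eq, sub_zero] at h
  exact (le_abs_self _).trans h.le

/-- The same clause from continuity of `β_{k+1}` itself at the zero history (`β¹_{k+1} = β_{k+1} − β⁰_{k+1}`). [folklore] -/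
theorem beta1_continuousWithinAt_zero_of_beta (S : OneLoopSplit β) {k : ℕ}
    (hc : ContinuousWithinAt (β k) {p : Fin (k + 1) → ℝ | ∀ i, 0 < p i} 0) :
    ContinuousWithinAt (S.β1 k) {p : Fin (k + 1) → ℝ | ∀ i, 0 < p i} 0 := by
  have hfun : S.β1 k = fun p => β k p - S.β0 k := funext fun p => by rw [S.split k p]; ring
  rw [hfun]
  exact hc.sub continuousWithinAt_const

/-- `hRk` from one-point continuity of `β_{k+1}` at the zero history. [cite: Balaban1987RG1, (2.12)-(2.14) p.268] -/
theorem hRk_of_beta_continuousWithinAt_zero (S : OneLoopSplit β) {k : ℕ}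
    (hc : ContinuousWithinAt (β k) {p : Fin (k + 1) → ℝ | ∀ i, 0 < p i} 0) :
    ∀ ε : ℝ, 0 < ε → ∃ γ : ℝ, 0 < γ ∧ ∀ p ∈ HistBox γ k, S.β1 k p ≤ ε :=
  hRk_of_beta1_continuousWithinAt_zero S (beta1_continuousWithinAt_zero_of_beta S hc)

/-! ## §2 (X-67) The refuting certificate at its weakest: one negative coefficient + one-point continuity at one scale -/

/-- **THE REFUTING CERTIFICATE AT ITS WEAKEST**: ONE certified-negative one-loop coefficient `β⁰_{k+1} < 0` at ONE scale plus continuity of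
`β_{k+1}` AT THE ZERO HISTORY (one point, one scale, from inside the orthant) refute (0.31) as typed, for every `L > 1` and every forward-generated
`C`; no (D4)-type bound, no tail, no other scale, no other point ((g)'s `not_thm2Printed_of_beta0_neg_oneScale` with `hRk` from §1).
[cite: Balaban1987RG1, Thm 2 (0.31) p.259] -/
theorem not_thm2Printed_of_beta0_neg_onePoint {C : B12.Construction} (hgen : ForwardGenerated C β) (S : OneLoopSplit β) {k : ℕ}
    (hneg : S.β0 k < 0) (hc : ContinuousWithinAt (β k) {p : Fin (k + 1) → ℝ | ∀ i, 0 < p i} 0) {L : ℝ} (hL : 1 < L) :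
    ¬ B12.Thm2Printed C L :=
  not_thm2Printed_of_beta0_neg_oneScale hgen S hneg (hRk_of_beta_continuousWithinAt_zero S hc) hL

/-- Certificate twin: a certified MAJORANT `β⁰_{k+1} ≤ m < 0` (interval-arithmetic output) in place of the exact value.  NO such certificate
exists to date. [cite: Balaban1987RG1, Thm 2 (0.31) p.259] -/
theorem not_thm2Printed_of_beta0_cert_onePoint {C : B12.Construction} (hgen : ForwardGenerated C β) (S : OneLoopSplit β) {k : ℕ}
    {m : ℝ} (hcert : S.β0 k ≤ m) (hm : m < 0) (hc : ContinuousWithinAt (β k) {p : Fin (k + 1) → ℝ | ∀ i, 0 < p i} 0) {L : ℝ}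
    (hL : 1 < L) : ¬ B12.Thm2Printed C L :=
  not_thm2Printed_of_beta0_neg_onePoint hgen S (hcert.trans_lt hm) hc hL

/-- The `β¹`-currency variant (continuity of the remainder part at the zero history). [cite: Balaban1987RG1, Thm 2 (0.31) p.259] -/
theorem not_thm2Printed_of_beta0_neg_onePoint' {C : B12.Construction} (hgen : ForwardGenerated C β) (S : OneLoopSplit β) {k : ℕ}
    (hneg : S.β0 k < 0) (hc : ContinuousWithinAt (S.β1 k) {p : Fin (k + 1) → ℝ | ∀ i, 0 < p i} 0) {L : ℝ} (hL : 1 < L) :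
    ¬ B12.Thm2Printed C L :=
  not_thm2Printed_of_beta0_neg_oneScale hgen S hneg (hRk_of_beta1_continuousWithinAt_zero S hc) hL

/-- What «the value at the zero history» means: `β_{k+1}(0,…,0) = β⁰_{k+1}` (d4-p3's `β0_eq_apply_zero`), so the refuting datum is the
sign of the full β-function at ONE point. [cite: Balaban1987RG1, (2.12)-(2.14) p.268] -/
theorem not_thm2Printed_of_betaAtZero_neg_onePoint {C : B12.Construction} (hgen : ForwardGenerated C β) (S : OneLoopSplit β) {k : ℕ}
    (hneg : β k 0 < 0) (hc : ContinuousWithinAt (β k) {p : Fin (k + 1) → ℝ | ∀ i, 0 < p i} 0) {L : ℝ} (hL : 1 < L) :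
    ¬ B12.Thm2Printed C L :=
  not_thm2Printed_of_beta0_neg_onePoint hgen S (by rw [β0_eq_apply_zero S k]; exact hneg) hc hL

/-! ## §3 (X-67) The printed one-variable case: `β_{k+1}` a function of `g_k` alone, continuous at `0` from the right -/

/-- **As printed ([I] p. 264)**: if `β_{k+1}(g_0,…,g_k) = f_{k+1}(g_k)` with `f_{k+1}` continuous at `0` from the right («smooth function
defined on the interval [0, γ]»), the one-point clause of §2 holds. [cite: Balaban1987RG1, (1.22) p.264] -/
theorem continuousWithinAt_zero_of_lastVar {k : ℕ} {f : ℝ → ℝ} (hβf : ∀ p : Fin (k + 1) → ℝ, β k p = f (p (Fin.last k)))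
    (hf : ContinuousWithinAt f (Set.Ioi 0) 0) : ContinuousWithinAt (β k) {p : Fin (k + 1) → ℝ | ∀ i, 0 < p i} 0 := by
  have hfun : β k = f ∘ fun p : Fin (k + 1) → ℝ => p (Fin.last k) := funext hβf
  rw [hfun]
  refine ContinuousWithinAt.comp (t := Set.Ioi 0) ?_ (continuous_apply (Fin.last k)).continuousWithinAt fun p hp => hp _
  simpa using hf

/-- The printed case end-to-end: ONE certified `β⁰_{k+1} < 0` + right-continuity of the one-variable `β_{k+1}(g_k)` at `0` ⟹ ¬(0.31) as typed.
[cite: Balaban1987RG1, Thm 2 (0.31) p.259 and (1.22) p.264] -/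
theorem not_thm2Printed_of_beta0_neg_lastVar {C : B12.Construction} (hgen : ForwardGenerated C β) (S : OneLoopSplit β) {k : ℕ}
    (hneg : S.β0 k < 0) {f : ℝ → ℝ} (hβf : ∀ p : Fin (k + 1) → ℝ, β k p = f (p (Fin.last k)))
    (hf : ContinuousWithinAt f (Set.Ioi 0) 0) {L : ℝ} (hL : 1 < L) : ¬ B12.Thm2Printed C L :=
  not_thm2Printed_of_beta0_neg_onePoint hgen S hneg (continuousWithinAt_zero_of_lastVar hβf hf) hL

/-! ## §4 (X-67) Binder (C) does NOT supply the clause: `BetaContH` lives on boxes open at the corner -/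

/-- `BetaContH γ β` restricted to one scale is continuity ON `]0,γ]^{k+1}` — a set not containing the zero history; the one-point clause of §2
is therefore an EXTRA (C)-type input at one point, not a consequence of binder (C). (Recorded as the trivial non-membership fact; no independence
claim is typed here.) [folklore] -/
theorem zero_not_mem_box {γ : ℝ} {k : ℕ} : (0 : Fin (k + 1) → ℝ) ∉ Box γ k := fun h =>
  (lt_irrefl (0 : ℝ)) (by simpa using (mem_box.mp h 0).1)

/-! ## §5 (this seat) … but continuity within the CLOSED box at the corner, at ONE scale, does -/

/-- **Ordering of the refutation road's inputs.**  Continuity of `β_{k+1}` at the zero history from within the CLOSED box `[0,γ]^{k+1}`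
(`γ > 0`; one scale of (g)'s `not_thm2Printed_of_beta0_neg_closedBox` supplier, [I] p. 264 reading) implies the orthant clause of §2 — the
orthant agrees with the closed box near the corner. [folklore] -/
theorem continuousWithinAt_orthant_of_closedBox {k : ℕ} {γ : ℝ} (hγ : 0 < γ) {f : (Fin (k + 1) → ℝ) → ℝ}
    (h : ContinuousWithinAt f (Set.pi Set.univ fun _ : Fin (k + 1) => Set.Icc 0 γ) 0) :
    ContinuousWithinAt f {p : Fin (k + 1) → ℝ | ∀ i, 0 < p i} 0 := by
  refine h.mono_of_mem_nhdsWithin ?_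
  have hball : Metric.ball (0 : Fin (k + 1) → ℝ) γ ∈ 𝓝 (0 : Fin (k + 1) → ℝ) := Metric.ball_mem_nhds 0 hγ
  filter_upwards [mem_nhdsWithin_of_mem_nhds hball, self_mem_nhdsWithin] with p hpb hpo
  rw [Set.mem_univ_pi]
  intro i
  have hd : dist p 0 < γ := hpb
  rw [dist_pi_lt_iff hγ] at hd
  have hi := hd i
  rw [Real.dist_eq, Pi.zero_apply, sub_zero, abs_lt] at hi
  exact ⟨(hpo i).le, hi.2.le⟩

/-- Hence: ONE certified `β⁰_{k+1} < 0` + continuity of `β_{k+1}` within the closed box `[0,γ]^{k+1}` at the corner, at THAT scale only ⟹ ¬(0.31)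
as typed ((g)'s `_closedBox` asks the closed-box continuity of `β¹` at EVERY scale). [cite: Balaban1987RG1, Thm 2 (0.31) p.259 and §1 p.264] -/
theorem not_thm2Printed_of_beta0_neg_closedBoxAt {C : B12.Construction} (hgen : ForwardGenerated C β) (S : OneLoopSplit β) {k : ℕ}
    (hneg : S.β0 k < 0) {γ : ℝ} (hγ : 0 < γ)
    (hc : ContinuousWithinAt (β k) (Set.pi Set.univ fun _ : Fin (k + 1) => Set.Icc 0 γ) 0) {L : ℝ} (hL : 1 < L) :
    ¬ B12.Thm2Printed C L :=
  not_thm2Printed_of_beta0_neg_onePoint hgen S hneg (continuousWithinAt_orthant_of_closedBox hγ hc) hL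

/-! ## §6 (this seat) The socket at block size `L' = L^n` from SMALL-block data (Q-asym1-5 currency) -/

variable {β' : HBeta}

/-- **REFUTATION AT THE LARGE BLOCK SIZE FROM A NEGATIVE SMALL-BLOCK SUM** (equality form `hblock` of Q-asym1-5): if the `L'`-construction's
one-loop coefficients are the block sums `Σ_{i<n} b_{nk+i}` of small-block coefficients `b`, then ONE negative block sum + one-point continuity
of the `L'`-construction's `β_{k+1}` at zero ⟹ `¬ B12.Thm2Printed C' L'` (`L' > 1`, forward generation). [cite: Balaban1987RG1, Thm 2 (0.31) p.259] -/
theorem not_thm2Printed_of_blockSum_neg_onePoint {C' : B12.Construction} (hgen : ForwardGenerated C' β') (S' : OneLoopSplit β')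
    {b : ℕ → ℝ} {n : ℕ} (hblock : ∀ k, S'.β0 k = blockSum n b k) {k : ℕ} (hneg : blockSum n b k < 0)
    (hc : ContinuousWithinAt (β' k) {p : Fin (k + 1) → ℝ | ∀ i, 0 < p i} 0) {L' : ℝ} (hL : 1 < L') : ¬ B12.Thm2Printed C' L' :=
  not_thm2Printed_of_beta0_neg_onePoint hgen S' (by rw [hblock k]; exact hneg) hc hL

/-- **NEARNESS FORM** (the honest currency for the genuine `L^n`-step, scheme (S3): `NearRate (blockSum n b) S'.β0 e ϑ`, i.e.
`|β⁰'_{k+1} − Σ_{i<n} b_{nk+i}| ≤ e·ϑ^k`): a block sum below `−e·ϑ^k` + the one-point clause ⟹ ¬(0.31) at `L'`. [cite: Balaban1987RG1, Thm 2 (0.31) p.259] -/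
theorem not_thm2Printed_of_blockSum_near_neg_onePoint {C' : B12.Construction} (hgen : ForwardGenerated C' β') (S' : OneLoopSplit β')
    {b : ℕ → ℝ} {n : ℕ} {e ϑ : ℝ} (hnear : NearRate (blockSum n b) S'.β0 e ϑ) {k : ℕ} (hneg : blockSum n b k + e * ϑ ^ k < 0)
    (hc : ContinuousWithinAt (β' k) {p : Fin (k + 1) → ℝ | ∀ i, 0 < p i} 0) {L' : ℝ} (hL : 1 < L') : ¬ B12.Thm2Printed C' L' := by
  have h1 := (abs_le.mp (hnear k)).2
  exact not_thm2Printed_of_beta0_neg_onePoint hgen S' (by linarith) hc hL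

/-- **CERTIFICATE FORM**: rational majorants `b_j ≤ hi_j` of the `n` small-block coefficients in block `k` with `Σ_{i<n} hi_{nk+i} < 0` (+ `hblock`
+ the one-point clause) refute (0.31) at `L'`.  NO small-block coefficient is certified to date. [cite: Balaban1987RG1, Thm 2 (0.31) p.259] -/
theorem not_thm2Printed_of_blockCert_neg_onePoint {C' : B12.Construction} (hgen : ForwardGenerated C' β') (S' : OneLoopSplit β')
    {b : ℕ → ℝ} {n : ℕ} (hblock : ∀ k, S'.β0 k = blockSum n b k) {k : ℕ} (hi : ℕ → ℚ)
    (hle : ∀ i, i < n → b (n * k + i) ≤ ((hi (n * k + i) : ℚ) : ℝ)) (hsum : ∑ i ∈ Finset.range n, hi (n * k + i) < 0)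
    (hc : ContinuousWithinAt (β' k) {p : Fin (k + 1) → ℝ | ∀ i, 0 < p i} 0) {L' : ℝ} (hL : 1 < L') : ¬ B12.Thm2Printed C' L' := by
  refine not_thm2Printed_of_blockSum_neg_onePoint hgen S' hblock (k := k) ?_ hc hL
  have h1 : blockSum n b k ≤ ∑ i ∈ Finset.range n, ((hi (n * k + i) : ℚ) : ℝ) :=
    Finset.sum_le_sum fun i hi' => hle i (Finset.mem_range.mp hi')
  have h2 : (∑ i ∈ Finset.range n, ((hi (n * k + i) : ℚ) : ℝ)) < 0 := by exact_mod_cast hsum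
  exact h1.trans_lt h2

/-- **THE TWO-SIDED TEST AT BLOCK SIZE `L'` FROM SMALL-BLOCK SUMS** (limit-form road of the `L'`-construction, its split with `hblock`, forward
generation, `L' > 1`): positive block sums below `k₀` ⟹ (0.31) at `L'` (the tree's `CapTailSigns.thm2Printed_of_signs`); ONE negative block sum
+ the one-point clause at that scale ⟹ ¬(0.31) at `L'`. [cite: Balaban1987RG1, Thm 2 (0.31) p.259] -/
theorem twoSidedTest_block_limitForm (D' : Beta.Assembly.LimitForm β') {C' : B12.Construction} (hgen : ForwardGenerated C' β')
    {b : ℕ → ℝ} {n : ℕ} (hblock : ∀ k, D'.S.β0 k = blockSum n b k) {L' : ℝ} (hL : 1 < L') :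
    ((∀ k, k < D'.k₀ → 0 < blockSum n b k) → B12.Thm2Printed C' L') ∧
      (∀ k, blockSum n b k < 0 → ContinuousWithinAt (β' k) {p : Fin (k + 1) → ℝ | ∀ i, 0 < p i} 0 → ¬ B12.Thm2Printed C' L') :=
  ⟨fun hsign => CapTailSigns.thm2Printed_of_signs D' hgen hL fun k hk => by rw [hblock k]; exact hsign k hk,
    fun _ hneg hc => not_thm2Printed_of_blockSum_neg_onePoint hgen D'.S hblock hneg hc hL⟩

/-- **THE POSITIVE SIDE FROM SMALL-BLOCK SIGNS** (no sums needed): `0 < n`, signs of the first `n·k₀` SMALL-block coefficients + `hblock` + the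
limit form of the `L'`-construction ⟹ (0.31) at `L'` (`CapBlockTransferFloors.blockSum_pos_of_pos` restricted to the listed blocks).
[cite: Balaban1987RG1, Thm 2 (0.31) p.259] -/
theorem thm2Printed_pow_of_smallBlockSigns (D' : Beta.Assembly.LimitForm β') {C' : B12.Construction} (hgen : ForwardGenerated C' β')
    {b : ℕ → ℝ} {n : ℕ} (hn : 0 < n) (hblock : ∀ k, D'.S.β0 k = blockSum n b k) {L' : ℝ} (hL : 1 < L')
    (hsign : ∀ j, j < n * D'.k₀ → 0 < b j) : B12.Thm2Printed C' L' := by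
  refine (twoSidedTest_block_limitForm D' hgen hblock hL).1 fun k hk => ?_
  refine Finset.sum_pos (fun i hi => hsign _ ?_) (Finset.nonempty_range_iff.mpr hn.ne')
  have hi' := Finset.mem_range.mp hi
  calc n * k + i < n * k + n := by omega
    _ = n * (k + 1) := by ring
    _ ≤ n * D'.k₀ := Nat.mul_le_mul_left n hk

/-- NUMBERS (which small block sizes can bear on a PRINTED block size under Q-asym1-5): print has «L odd > 11» ([I] p. 251); powers of an odd
block size stay odd and powers of 2 never are (`Nat.odd_pow_iff`): `2^4 = 16` is not odd, while `3^3 = 27` and `5^2 = 25` are odd and exceed 11.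
So a certified finding at block size 3 (`n = 3`) or 5 (`n = 2`) transfers to a printed block size along §6, one at block size 2 (the CA-1 ∕
ENGINE-A instance) to none. [cite: Balaban1987RG1, p.251] -/
theorem pow_blockSizes : ¬ Odd (2 ^ 4) ∧ Odd (3 ^ 3) ∧ 11 < 3 ^ 3 ∧ Odd (5 ^ 2) ∧ 11 < 5 ^ 2 ∧ ∀ n : ℕ, n ≠ 0 → ¬ Odd (2 ^ n) := by
  refine ⟨by decide, by decide, by decide, by decide, by decide, fun n hn h => ?_⟩
  exact absurd ((Nat.odd_pow_iff hn).mp h) (by decide)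

end

end Summit.QuantumFields.BalabanUV.Gaps.CapNegSocketOnePoint
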